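import Summits.FinalStateConjecture.FinalStateConjecture.Theorems.ClusterCompletenessRecurrentlyFlatDispersesStubAnchorCone
import Summits.FinalStateConjecture.FinalStateConjecture.Theorems.ClusterCompletenessRecurrentlyFlatDispersesStubChartFuture
import Summits.FinalStateConjecture.FinalStateConjecture.Theorems.ClusterCompletenessRecurrentlyFlatDispersesStubFutureSet
import Summits.FinalStateConjecture.FinalStateConjecture.Theorems.ClusterCompletenessRecurrentlyFlatDispersesSlabCauchyExit
import Literature.Geometry.Lorentzian.CausalCurveNullGeodesic
import Literature.Geometry.Lorentzian.CausalityClosure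
import Literature.Geometry.Manifold.InverseFunctionTheorem

/-!
# Crux `RecurrentlyFlatDisperses` (stmt-FinalStateConjecture-14665), line `Sketch` — the anchored chart
# region is closed under CAUSAL futures, and its late slabs are ACAUSAL

Continuation lead c3, 2026-08-16. Two more geometric consequences of the crux's anchored-chart
hypothesis, completing the causal picture of the late image `W = Ψ₀{x⁰ > τ₀}` (landed so far: `W` is
a future set `I⁺(W) ⊆ W` and `I⁺(S_τ) ⊆ Ψ₀{x⁰ > τ}` — `stub_futureSet`; late slabs are met by
past-endless causal curves from above — `stub_slabCauchy`; are closed — `isClosed_image_timeSlab`;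
chart time is exhausted along future-endless causal curves — `exists_mem_image_lateRegion`):

* `causalFuture_image_lateRegion_subset` — `J⁺(W) ⊆ W`: a point `q ≥ p ∈ W` is `≫` some
  `p' ∈ W ∩ I⁻(p)` (`W` is open and `p ∈ closure I⁻(p)`, `mem_closure_chronologicalFuture_self`
  for the reversed orientation), by push-up (`x ≪ y ≤ z ⇒ x ≪ z`,
  `mem_chronologicalFuture_of_mem_causalFuture_of_mem_chronologicalFuture`, O'Neill 1983, Ch. 14,
  Cor. 14.1), so `q ∈ I⁺(W) ⊆ W`;
* `image_timeSlab_acausal` — every late slab `S_τ = Ψ₀{x⁰ = τ}` is ACAUSAL: two points of `S_τ`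
  joined by a future causal curve coincide, because the curve stays in `W` (first bullet, applied to
  its initial segments) and the chart time of its lift increases strictly (landed causal cone estimate
  and lift, `SlabCauchy.lift_cone_causal`, `FutureSet.strictMonoOn_apply_zero`) while both endpoints
  have chart time `τ`.

General anchored-chart forms `ChartCausal.causalFuture_subset_of_chart`, `ChartCausal.acausal_of_chart`;
crux-vocabulary forms with the side conditions discharged by the landed `stub_anchorCone`,
`stub_chartFuture`, `stub_futureSet`. Mathlib + the Literature cone + landed bricks; no definitions,
no named facts.
-/

noncomputable section

open scoped Manifold ContDiff Topology
open Bundle Filter Set Function TopologicalSpace Literature.Geometry.Lorentzian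

namespace Summit.FinalStateConjecture.FinalStateConjecture.Theorems.RecurrentlyFlatDisperses

namespace ChartCausal

/-- `1 ≤ ∞` in `ℕ∞ω` (the regularity threshold of push-up). -/
private lemma one_le_infty : (1 : ℕ∞ω) ≤ ∞ := WithTop.coe_le_coe.mpr le_top

/-- **An open future set is closed under causal futures**: if `W` is open and `I⁺(W) ⊆ W` in a
spacetime (manifold without boundary), then `J⁺(W) ⊆ W`. -/
theorem causalFuture_subset_of_futureSet {𝓢 : Spacetime 4} {W : Set 𝓢.carrier} (hWopen : IsOpen W)
    (hF : 𝓢.metric.chronologicalFuture 𝓢.timeOrientation W ⊆ W) :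
    𝓢.metric.causalFuture 𝓢.timeOrientation W ⊆ W := by
  intro q hq
  rcases hq with hq | ⟨p, hp, γ, a, b, hab, hγ, hγa, hγb⟩
  · exact hq
  · -- `p ∈ closure I⁻(p)` and `W` is an open neighbourhood of `p`: some `p' ∈ W` has `p' ≪ p`
    have hcl : p ∈ closure (𝓢.metric.chronologicalPast 𝓢.timeOrientation {p}) :=
      𝓢.metric.mem_closure_chronologicalFuture_self 𝓢.timeOrientation.reverse (p := p)
        BoundarylessManifold.isInteriorPoint
    obtain ⟨p', hp'W, hp'I⟩ := mem_closure_iff_nhds.mp hcl _ (hWopen.mem_nhds hp)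
    have hpp' : p ∈ 𝓢.metric.chronologicalFuture 𝓢.timeOrientation {p'} :=
      LorentzianMetric.mem_chronologicalFuture_of_mem_chronologicalPast hp'I
    -- `q ≥ p ≫ p'`, so `q ≫ p'` (push-up) and `q ∈ I⁺(W) ⊆ W`
    have hqp : q ∈ 𝓢.metric.causalFuture 𝓢.timeOrientation {p} :=
      Or.inr ⟨p, mem_singleton _, γ, a, b, hab, hγ, hγa, hγb⟩
    have hqp' : q ∈ 𝓢.metric.chronologicalFuture 𝓢.timeOrientation {p'} :=
      mem_chronologicalFuture_of_mem_causalFuture_of_mem_chronologicalFuture 𝓢.timeOrientation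
        one_le_infty hpp' hqp
    obtain ⟨_, hx, γ', a', b', hab', hγ', hγ'a, hγ'b⟩ := hqp'
    rw [mem_singleton_iff] at hx
    exact hF ⟨p', hp'W, γ', a', b', hab', hγ', hγ'a.trans hx, hγ'b⟩

/-- **Acausality of the late slabs of an anchored chart (geometric form).** Let `Ψ₀ : U₀ → 𝓢` be a
smooth map on an open `U₀ ⊇ {x⁰ > τ₀}` of `E4` which is an open embedding on the late region
`{x⁰ > τ₀}`, anchored (`‖Ψ₀^* g − η‖ ≤ 1/4` pointwise on the late region) with `dΨ₀ ∂₀`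
future-directed there, whose late image `W` satisfies `J⁺(W) ⊆ W`. Then two points of a late slab
`Ψ₀{x⁰ = τ}`, `τ > τ₀`, one in the causal future of the other, coincide. -/
theorem acausal_of_chart {𝓢 : Spacetime 4} {U₀ : Opens E4} {Ψ₀ : U₀ → 𝓢.carrier} {τ₀ : ℝ}
    (hΨs : ContMDiff 𝓘(ℝ, E4) (𝓡 4) ∞ Ψ₀)
    (hemb : Topology.IsOpenEmbedding (((Minkowski.backgroundOn U₀).lateRegion τ₀).restrict Ψ₀))
    (hU : {x : E4 | τ₀ < x 0} ⊆ (U₀ : Set E4))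
    (hdev : ∀ y : U₀, τ₀ < y.1 0 → ‖𝓢.deviation (Minkowski.backgroundOn U₀) Ψ₀ y‖ ≤ 1 / 4)
    (hfut : ∀ y : U₀, τ₀ < y.1 0 →
      𝓢.timeOrientation.IsFutureDirected (mfderiv 𝓘(ℝ, E4) (𝓡 4) Ψ₀ y (E4.basisVector 0)))
    (hJ : 𝓢.metric.causalFuture 𝓢.timeOrientation (Ψ₀ '' (Minkowski.backgroundOn U₀).lateRegion τ₀) ⊆
      Ψ₀ '' (Minkowski.backgroundOn U₀).lateRegion τ₀)
    {τ : ℝ} (hτ : τ₀ < τ) {p q : 𝓢.carrier}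
    (hp : p ∈ Ψ₀ '' (Minkowski.backgroundOn U₀).timeSlab τ)
    (hq : q ∈ Ψ₀ '' (Minkowski.backgroundOn U₀).timeSlab τ)
    (hpq : q ∈ 𝓢.metric.causalFuture 𝓢.timeOrientation {p}) : p = q := by
  rcases hpq with hpq | ⟨p₀, hp₀, γ, a, b, hab, hγ, hγa, hγb⟩
  · exact (mem_singleton_iff.mp hpq).symm
  rw [mem_singleton_iff] at hp₀
  subst hp₀
  exfalso
  -- the late half-space `V` and the chart `Φ = Ψ₀|V` (as in the landed `stub_slabCauchy`)
  obtain ⟨V, hVmem⟩ : ∃ V : Opens E4, ∀ p : E4, p ∈ V ↔ τ₀ < p 0 :=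
    ⟨⟨{x : E4 | τ₀ < x 0}, isOpen_lt continuous_const (PiLp.continuous_apply 2 _ 0)⟩,
      fun _ ↦ Iff.rfl⟩
  have hVU : V ≤ U₀ := fun p hp ↦ hU ((hVmem p).1 hp)
  haveI : Nonempty V :=
    ⟨⟨(τ₀ + 1) • (E4.basisVector 0 : E4), (hVmem _).2 (by simp [E4.basisVector])⟩⟩
  have hlate : ∀ x : V, τ₀ < (Opens.inclusion hVU x).1 0 := fun x ↦ (hVmem x.1).1 x.2
  set Φ : V → 𝓢.carrier := Ψ₀ ∘ Opens.inclusion hVU with hΦdef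
  have hΦs : ContMDiff 𝓘(ℝ, E4) (𝓡 4) ∞ Φ := hΨs.comp (contMDiff_inclusion hVU)
  have hdΦ : ∀ x : V, mfderiv 𝓘(ℝ, E4) (𝓡 4) Φ x =
      mfderiv 𝓘(ℝ, E4) (𝓡 4) Ψ₀ (Opens.inclusion hVU x) := fun x ↦
    FutureSet.mfderiv_comp_inclusion hVU x (hΨs.mdifferentiableAt (by simp))
  have hrange : range Φ = Ψ₀ '' (Minkowski.backgroundOn U₀).lateRegion τ₀ :=
    FutureSet.range_comp_inclusion hVU Ψ₀ hVmem
  have hinj : Injective Φ := by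
    intro x₁ x₂ h
    have h' : (⟨Opens.inclusion hVU x₁, hlate x₁⟩ :
        (Minkowski.backgroundOn U₀).lateRegion τ₀) = ⟨Opens.inclusion hVU x₂, hlate x₂⟩ :=
      hemb.injective h
    exact Subtype.ext (congrArg (fun y : (Minkowski.backgroundOn U₀).lateRegion τ₀ ↦
      (y.1 : E4)) h')
  have hloc : IsLocalDiffeomorph 𝓘(ℝ, E4) (𝓡 4) ∞ Φ := fun x ↦ by
    have hinjd : Injective (mfderiv 𝓘(ℝ, E4) (𝓡 4) Φ x) := by
      rw [hdΦ x]
      exact FutureSet.mfderiv_injective_of_deviation Ψ₀ _ (hdev _ (hlate x))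
    set A : E4 →L[ℝ] E4 := mfderiv 𝓘(ℝ, E4) (𝓡 4) Φ x with hA
    have hinjA : Injective (A : E4 →ₗ[ℝ] E4) := hinjd
    have hbij : Bijective (A : E4 →ₗ[ℝ] E4) :=
      ⟨hinjA, LinearMap.injective_iff_surjective.1 hinjA⟩
    set e : E4 ≃L[ℝ] E4 := (LinearEquiv.ofBijective (A : E4 →ₗ[ℝ] E4) hbij).toContinuousLinearEquiv
      with he
    exact Literature.Geometry.Manifold.isLocalDiffeomorphAt_of_mfderiv (by simp) isOpen_univ
      (mem_univ x) hΦs.contMDiffOn e (by ext v; rfl)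
  have hcone : ∀ (x : V) (w : E4),
      𝓢.timeOrientation.IsFutureDirected (mfderiv 𝓘(ℝ, E4) (𝓡 4) Φ x w) →
      0 < w 0 ∧ ‖w‖ < 2 * w 0 := by
    intro x w hf
    rw [hdΦ x] at hf
    exact SlabCauchy.cone_of_deviation_causal Ψ₀ (Opens.inclusion hVU x) (hdev _ (hlate x))
      (hfut _ (hlate x)) w hf
  -- the slab points read through `Φ`
  obtain ⟨yp, hyp, rfl⟩ := hp
  obtain ⟨yq, hyq, hyqb⟩ := hq
  have hyp' : (yp : E4) 0 = τ := hyp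
  have hyq' : (yq : E4) 0 = τ := hyq
  set xp : V := ⟨(yp : E4), (hVmem _).2 (by rw [hyp']; exact hτ)⟩ with hxp
  set xq : V := ⟨(yq : E4), (hVmem _).2 (by rw [hyq']; exact hτ)⟩ with hxq
  have hΦp : Φ xp = Ψ₀ yp := congrArg Ψ₀ (Subtype.ext rfl)
  have hΦq : Φ xq = Ψ₀ yq := congrArg Ψ₀ (Subtype.ext rfl)
  -- the curve stays in `W = range Φ` (causal closedness applied to initial segments)
  have hW : ∀ v ∈ Icc a b, γ v ∈ range Φ := fun v hv ↦ by
    rw [hrange]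
    have h1 : γ v ∈ 𝓢.metric.causalFuture 𝓢.timeOrientation {γ a} :=
      IsFutureCausalCurveOn.apply_mem_causalFuture 𝓢.timeOrientation hv.1
        (hγ.mono (Icc_subset_Icc_right hv.2))
    refine hJ ?_
    rcases h1 with h1 | ⟨_, hx, γ', a', b', hab', hγ', hγ'a, hγ'b⟩
    · rw [mem_singleton_iff] at h1
      rw [h1, hγa, ← hΦp, ← hrange]
      exact Or.inl ⟨xp, rfl⟩
    · rw [mem_singleton_iff] at hx
      refine Or.inr ⟨γ a, ?_, γ', a', b', hab', hγ', hγ'a.trans hx, hγ'b⟩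
      rw [hγa, ← hΦp, ← hrange]
      exact ⟨xp, rfl⟩
  -- chart time increases strictly along the lift, yet both ends have chart time `τ`
  set c : ℝ → E4 := fun u ↦ ((Function.invFun Φ (γ u) : V) : E4) with hc
  have hder : ∀ v ∈ Icc a b, HasDerivAt c (deriv c v) v ∧ 0 < deriv c v 0 := fun v hv ↦ by
    obtain ⟨hd, h1, -⟩ := SlabCauchy.lift_cone_causal hΦs hinj hloc hcone (hγ v hv).1 (hγ v hv).2
      (hW v hv)
    exact ⟨hd, h1⟩
  have hmono : StrictMonoOn (fun v ↦ c v 0) (Icc a b) :=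
    FutureSet.strictMonoOn_apply_zero (w := fun v ↦ deriv c v) (convex_Icc a b) hder
  have hlt : c a 0 < c b 0 := hmono ⟨le_rfl, hab.le⟩ ⟨hab.le, le_rfl⟩ hab
  have hca : Function.invFun Φ (γ a) = xp := by
    rw [hγa, ← hΦp]
    exact Function.leftInverse_invFun hinj xp
  have hcb : Function.invFun Φ (γ b) = xq := by
    rw [hγb, ← hyqb, ← hΦq]
    exact Function.leftInverse_invFun hinj xq
  have h1 : c a 0 = τ := by
    show ((Function.invFun Φ (γ a) : V) : E4) 0 = τ
    rw [hca]
    exact hyp'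
  have h2 : c b 0 = τ := by
    show ((Function.invFun Φ (γ b) : V) : E4) 0 = τ
    rw [hcb]
    exact hyq'
  rw [h1, h2] at hlt
  exact lt_irrefl _ hlt

end ChartCausal

/-! ### The crux-vocabulary forms -/

/-- **The late image of the crux's anchored flat chart is closed under causal futures, `J⁺(W) ⊆ W`.**
Hypotheses = the five anchored-chart conjuncts of `Theses.ClusterCompleteness.RecurrentlyFlatDisperses`,
verbatim; `I⁺(W) ⊆ W` is the landed `stub_futureSet`, openness of `W` is the late-chart clause. -/
theorem causalFuture_image_lateRegion_subset :
    ∀ (X : Type) [TopologicalSpace X] [ChartedSpace E3 X] [IsManifold (𝓡 3) ∞ X] [T2Space X]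
      [SecondCountableTopology X] [ConnectedSpace X],
      ∀ D ∈ admissibleVacuumData X, ∀ 𝒟 : VacuumCauchyDevelopment D, 𝒟.IsMaximal →
        ∀ (O : Set 𝒟.carrier) (τ₀ : ℝ) (U₀ : Opens E4) (Ψ₀ : U₀ → 𝒟.carrier),
          (𝒟.toSpacetime.IsLateChart (Minkowski.backgroundOn U₀) O τ₀ Ψ₀ ∧
            {x : E4 | τ₀ < x 0} ⊆ (U₀ : Set E4) ∧
            O = Summit.FinalStateConjecture.exteriorOf 𝒟.toCauchyDevelopment
              (Ψ₀ '' (Minkowski.backgroundOn U₀).lateRegion τ₀) ∧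
            (∀ τ₁ : ℝ, τ₀ < τ₁ → O \ Ψ₀ '' (Minkowski.backgroundOn U₀).lateRegion τ₁ ⊆
              𝒟.metric.causalPast 𝒟.timeOrientation
                (Ψ₀ '' (Minkowski.backgroundOn U₀).timeSlab τ₁)) ∧
            (∀ τ : ℝ, τ₀ < τ → 𝒟.toSpacetime.deviationCk (Minkowski.backgroundOn U₀) Ψ₀ 0 τ ≤
              ENNReal.ofReal (1 / 4))) →
          𝒟.metric.causalFuture 𝒟.timeOrientation (Ψ₀ '' (Minkowski.backgroundOn U₀).lateRegion τ₀) ⊆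
            Ψ₀ '' (Minkowski.backgroundOn U₀).lateRegion τ₀ := by
  intro X _ _ _ _ _ _ D hD 𝒟 hmax O τ₀ U₀ Ψ₀ hyp
  have hA := stub_anchorCone
  have hT := stub_chartFuture hA
  have hF := (stub_futureSet hA hT X D hD 𝒟 hmax O τ₀ U₀ Ψ₀ hyp).1
  obtain ⟨hchart, -, -, -, -⟩ := hyp
  have hWopen : IsOpen (Ψ₀ '' (Minkowski.backgroundOn U₀).lateRegion τ₀) := by
    rw [← Set.range_restrict]
    exact hchart.isOpenEmbedding.isOpen_range
  exact ChartCausal.causalFuture_subset_of_futureSet (𝓢 := 𝒟.toSpacetime) hWopen hF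

/-- **The late slabs of the crux's anchored flat chart are acausal.** Hypotheses = the five
anchored-chart conjuncts of `Theses.ClusterCompleteness.RecurrentlyFlatDisperses`, verbatim: for
`τ > τ₀`, two points of `Ψ₀ '' timeSlab τ`, one in the causal future of the other, coincide. -/
theorem image_timeSlab_acausal :
    ∀ (X : Type) [TopologicalSpace X] [ChartedSpace E3 X] [IsManifold (𝓡 3) ∞ X] [T2Space X]
      [SecondCountableTopology X] [ConnectedSpace X],
      ∀ D ∈ admissibleVacuumData X, ∀ 𝒟 : VacuumCauchyDevelopment D, 𝒟.IsMaximal →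
        ∀ (O : Set 𝒟.carrier) (τ₀ : ℝ) (U₀ : Opens E4) (Ψ₀ : U₀ → 𝒟.carrier),
          (𝒟.toSpacetime.IsLateChart (Minkowski.backgroundOn U₀) O τ₀ Ψ₀ ∧
            {x : E4 | τ₀ < x 0} ⊆ (U₀ : Set E4) ∧
            O = Summit.FinalStateConjecture.exteriorOf 𝒟.toCauchyDevelopment
              (Ψ₀ '' (Minkowski.backgroundOn U₀).lateRegion τ₀) ∧
            (∀ τ₁ : ℝ, τ₀ < τ₁ → O \ Ψ₀ '' (Minkowski.backgroundOn U₀).lateRegion τ₁ ⊆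
              𝒟.metric.causalPast 𝒟.timeOrientation
                (Ψ₀ '' (Minkowski.backgroundOn U₀).timeSlab τ₁)) ∧
            (∀ τ : ℝ, τ₀ < τ → 𝒟.toSpacetime.deviationCk (Minkowski.backgroundOn U₀) Ψ₀ 0 τ ≤
              ENNReal.ofReal (1 / 4))) →
          ∀ τ : ℝ, τ₀ < τ → ∀ p ∈ Ψ₀ '' (Minkowski.backgroundOn U₀).timeSlab τ,
            ∀ q ∈ Ψ₀ '' (Minkowski.backgroundOn U₀).timeSlab τ,
              q ∈ 𝒟.metric.causalFuture 𝒟.timeOrientation {p} → p = q := by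
  intro X _ _ _ _ _ _ D hD 𝒟 hmax O τ₀ U₀ Ψ₀ hyp τ hτ p hp q hq hpq
  have hA := stub_anchorCone
  have hT := stub_chartFuture hA
  have hdev : ∀ y : U₀, τ₀ < y.1 0 →
      ‖𝒟.toSpacetime.deviation (Minkowski.backgroundOn U₀) Ψ₀ y‖ ≤ 1 / 4 :=
    hA X D hD 𝒟 hmax O τ₀ U₀ Ψ₀ hyp
  have hfut : ∀ y : U₀, τ₀ < y.1 0 →
      𝒟.timeOrientation.IsFutureDirected (mfderiv 𝓘(ℝ, E4) (𝓡 4) Ψ₀ y (E4.basisVector 0)) :=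
    hT X D hD 𝒟 hmax O τ₀ U₀ Ψ₀ hyp
  have hJ := causalFuture_image_lateRegion_subset X D hD 𝒟 hmax O τ₀ U₀ Ψ₀ hyp
  obtain ⟨hchart, hU, -, -, -⟩ := hyp
  exact ChartCausal.acausal_of_chart (𝓢 := 𝒟.toSpacetime) hchart.contMDiff hchart.isOpenEmbedding
    hU hdev hfut hJ hτ hp hq hpq

end Summit.FinalStateConjecture.FinalStateConjecture.Theorems.RecurrentlyFlatDisperses

end
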